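import Summits.BirchSwinnertonDyer.BirchSwinnertonDyer.Theorems.AlignedTransportAtTwoMainConjectureOfRankZeroBSDAtTwoLayerValuePalindrome
import Literature.Algebra.Polynomial.QPalindromicRealCounterpart
import HarnessLib

/-!
# Route `AlignedTransportAtTwo`, crux C2 `MainConjectureOfRankZeroBSDAtTwo` (stmt-BirchSwinnertonDyer-22298):
# THE HALF-DEGREE DESCENT — the distinguished polynomial `P` of an `ι`-stable `F ∈ ℤ_p⟦T⟧` (`F ≢ 0 (mod p)`, `F(0) ≠ 0`, `λ = 2m`)
# is `P(T) = (1+T)^m · h(γ + γ⁻¹)`, `γ = 1 + T`, for a UNIQUE monic `h ∈ ℤ_p[Y]` of degree `m = λ/2` with `h ≡ (Y − 2)^m (mod p)` —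
# the «real counterpart» of the palindromic `P(X − 1)`; so `(F) = (p^μ · h(γ + γ⁻¹))` is generated by an `ι`-FIXED element (any `p`)

HONEST FRAMING (cell `bsd-f1-sign2`, WIDTH-5 attached prover seat `bsd-line-att-p5` gen 51 on line `birth` of the lead `bsd-line-att-p2`;
`--supports` stmt-BirchSwinnertonDyer-22298, closes nothing; BSD is NOT proved by any of this; the crux C2, its verdict «blocked-on
`Rank1Residual.GreenbergMuConjectureIrreducible`» and every registered stub (P / T / Kμ / LimDoor / MuIneqʳ / PFμ⁺) are untouched). THEOREMS ONLY —
pure algebra, any prime `p`; no `def`, no instance, no named fact, no `sorry`. Lineage glue on g50's successor (ii) («λ = 4 palindromic bookkeeping»),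
done for every `λ` at once: g50's `…LayerValuePalindrome` (`(1+T)^λ·ι(P) = P`, i.e. `P̃(X) := P(X−1)` is PALINDROMIC) composed with the tree's
port of Goresky–Tai's «real counterpart» of a `q`-palindromic polynomial (`Literature.Algebra.Polynomial.QPalindromicRealCounterpart`, `q = 1`).

THE POINT. A palindromic monic `P̃` of degree `2m` is `X^m·h(X + X⁻¹)` for a unique monic `h` of degree `m` (the real Weil polynomial of a Weil
polynomial, here with `q = 1`). For the Iwasawa involution `ι : γ ↦ γ⁻¹` (`X = γ = 1+T`) this says: the characteristic element of an `ι`-self-dual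
torsion `Λ`-module DESCENDS to the `ι`-fixed ring `ℤ_p⟦γ + γ⁻¹⟧` — `P = (1+T)^m·h(γ + γ⁻¹)` — and ALL its special values at `T = ζ − 1` are values
of ONE polynomial `h` of HALF the degree at the real points `ζ + ζ⁻¹`: `P(ζ − 1) = ζ^m·h(ζ + ζ⁻¹)` (trivial character `h(2)`, order-`2` character
`(−1)^m h(−2)`, order `4`: `ζ^m h(0)`, order `8`: `ζ^m h(±√2)`, …; sibling `…HalfDescentValues`).
* §1 (any commutative ring) the bridge between the tree's reciprocal `Q_d(P) = ∑ a_k(−T)^k(1+T)^{d−k}` and Mathlib's `reflect`: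
  `reflect_comp_X_sub_one` (`X^d P̃(1/X) = Q_d(P)(X−1)`), `pal_comp_X_sub_one` (`Q_{2m}(P) = P` ⟹ `P̃` palindromic), ★★ `exists_eq_transform_of_reciprocal_eq`.
* §2 back to `T`: `eq_transform_comp_X_add_one` (`P(T) = ∑ b_j (1+T)^{m−j}((1+T)²+1)^j`).
* §3 (`Λ = ℤ_p⟦T⟧`) `reciprocal_eq_of_invol`; converse ★★ `invol_transform_comp_X_add_one` (every `h` gives an `ι`-palindromic `P` — a complete
  parametrisation); ★★★ **`existsUnique_realCounterpart`** (`F ≢ 0`, `F(0) ≠ 0`, `ι F = uF`, `deg P = 2m` ⟹ `∃! h` monic of degree `m`, `P(X−1) =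
  ∑ b_j X^{m−j}(X²+1)^j`); ★★ `map_residue_realCounterpart` (**`h ≡ (Y−2)^m (mod p)`**; at `p = 2`: `h` is distinguished); ★★ `coe_eq_one_add_X_pow_mul_aeval`
  (**`P = (1+T)^m · h(γ + γ⁻¹)` in `Λ`**, `γ⁻¹ = ι(1+T)`); ★★★ `exists_eq_aeval_realCounterpart_mul_unit` / `exists_eq_C_pow_mu_mul_aeval_mul_unit`
  (**`F = p^{μ(F)}·h(γ + γ⁻¹)·w`, `w ∈ Λˣ`**); `(μ, λ)` form ★★★ `existsUnique_realCounterpart_of_lam` (`λ(F) = 2m`; `invol_pfree`).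
`λ = 2` is g50's `T² + qT + q` (`h = Y + (q − 2)`); `λ = 4` is `h = Y² + c₁Y + c₀`, i.e. `P = T⁴ + (c₁+4)T³ + (c₀+3c₁+8)T² + 2p₀T + p₀`, `p₀ = h(2) = c₀ + 2c₁ + 4`.
At odd `p` the hypothesis «`λ` even» is automatic (sibling `…HalfDescentValues.even_natDegree_weierstrassDistinguished_of_odd_prime`); at `p = 2` it is
the parity `F(−2) ≠ 0` (g49 `even_lam_of_iotaStable'`, Matsuno 2008 Prop. 6.4). Memo `Cruxes/MainConjectureOfRankZeroBSDAtTwo/HALF-DESCENT-att-p5-g51.md`.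
BSD is not proved by any of this; nothing about any curve is asserted here.

References: M. Goresky, Y.-S. Tai, arXiv:1701.07742, App. §16.2 Prop. 36 [GoreskyTai2017RealStructuresOrdinary]; B. Mazur, J. Tate, J. Teitelbaum,
Invent. Math. 84 (1986) Ch. I §17 (the involution) [MazurTateTeitelbaum1986Invent]; L. Washington, GTM 83, §7.1 [Washington1997]; R. Greenberg, LNM 1716
(1999), Thm. 1.14, §5 p. 181 [GreenbergLNM1716]; K. Matsuno, IJNT 4 (2008) Prop. 6.4 [Matsuno2008].
-/

set_option linter.dupNamespace false
set_option autoImplicit false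

noncomputable section

open scoped Classical

namespace Summit.BirchSwinnertonDyer.BirchSwinnertonDyer.Theorems.AlignedTransportAtTwoHalfDescent

open PowerSeries Literature.NumberTheory.EllipticCurves
  Literature.NumberTheory.EllipticCurves.IwasawaAlgebra
  Literature.Algebra.Polynomial.QPalindromicRealCounterpart
  Summit.BirchSwinnertonDyer.Rank1Residual.X1.MuLambda
  Summit.BirchSwinnertonDyer.Rank1Residual.Iwasawa
  Summit.BirchSwinnertonDyer.BirchSwinnertonDyer.Theorems.AlignedTransportAtTwoLayerValuePalindrome

/-! ## §1 The reflection bridge: `X^d · P̃(1/X)` versus the tree's reciprocal `Q_d(P)` (any commutative ring) -/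

section Reflect

variable {R : Type*} [CommRing R]

/-- `reflect` is additive over finite sums. [folklore] -/
theorem reflect_finsetSum {ι : Type*} (s : Finset ι) (f : ι → Polynomial R) (N : ℕ) :
    (∑ i ∈ s, f i).reflect N = ∑ i ∈ s, (f i).reflect N := by
  classical
  induction s using Finset.induction_on with
  | empty => rw [Finset.sum_empty, Finset.sum_empty, Polynomial.reflect_zero]
  | insert a s ha ih => rw [Finset.sum_insert ha, Finset.sum_insert ha, Polynomial.reflect_add, ih]

/-- `reflect k ((X − a)^k) = (1 − a·X)^k` (the reverse of `X − a` is `1 − aX`). [folklore] -/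
theorem reflect_X_sub_C_pow (a : R) (k : ℕ) :
    ((Polynomial.X - Polynomial.C a) ^ k).reflect k = (1 - Polynomial.C a * Polynomial.X) ^ k := by
  induction k with
  | zero => rw [pow_zero, pow_zero, Polynomial.reflect_one, pow_zero]
  | succ k ih =>
    have hX : (Polynomial.X : Polynomial R).reflect 1 = 1 := by
      have h := Polynomial.reflect_monomial (R := R) 1 1
      rwa [pow_one, Polynomial.revAt_le (le_refl 1), Nat.sub_self, pow_zero] at h
    have h1 : ((Polynomial.X - Polynomial.C a : Polynomial R)).reflect 1 = 1 - Polynomial.C a * Polynomial.X := by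
      rw [Polynomial.reflect_sub, hX, Polynomial.reflect_C, pow_one]
    rw [pow_succ, Polynomial.reflect_mul _ _ (F := k) (G := 1)
        ((Polynomial.natDegree_pow_le).trans (by
          calc k * (Polynomial.X - Polynomial.C a).natDegree ≤ k * 1 := by
                gcongr; exact Polynomial.natDegree_X_sub_C_le _
            _ = k := mul_one k))
        (Polynomial.natDegree_X_sub_C_le a),
      ih, h1, pow_succ]

/-- **The bridge.** For `P` of degree `≤ d`, `X^d·P̃(1/X)` (Mathlib's `reflect d` of `P̃(X) := P(X − 1)`) is `Q_d(P)(X − 1)`, where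
`Q_d(P)(T) = ∑_k a_k (−T)^k (1+T)^{d−k}` is the tree's reciprocal (`…LayerValuePalindrome.one_add_X_pow_mul_invol_coe`:
`(1+T)^d·ι(P) = Q_d(P)` in `Λ`). [folklore] -/
theorem reflect_comp_X_sub_one (P : Polynomial R) {d : ℕ} (hd : P.natDegree ≤ d) :
    (P.comp (Polynomial.X - Polynomial.C 1)).reflect d =
      (∑ k ∈ Finset.range (d + 1), Polynomial.C (P.coeff k) * (-Polynomial.X) ^ k * (1 + Polynomial.X) ^ (d - k)).comp
        (Polynomial.X - Polynomial.C 1) := by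
  have hP : P.comp (Polynomial.X - Polynomial.C 1) =
      ∑ k ∈ Finset.range (d + 1), Polynomial.C (P.coeff k) * (Polynomial.X - Polynomial.C 1) ^ k := by
    conv_lhs => rw [P.as_sum_range' (d + 1) (Nat.lt_succ_of_le hd)]
    rw [Polynomial.sum_comp]
    refine Finset.sum_congr rfl fun k _ ↦ ?_
    rw [← Polynomial.C_mul_X_pow_eq_monomial, Polynomial.mul_comp, Polynomial.C_comp, Polynomial.pow_comp, Polynomial.X_comp]
  rw [hP, reflect_finsetSum, Polynomial.sum_comp]
  refine Finset.sum_congr rfl fun k hk ↦ ?_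
  rw [Finset.mem_range] at hk
  have hk' : k ≤ d := Nat.le_of_lt_succ hk
  have hdeg : ((Polynomial.X - Polynomial.C (1 : R)) ^ k).natDegree ≤ k :=
    (Polynomial.natDegree_pow_le).trans (by
      calc k * (Polynomial.X - Polynomial.C (1 : R)).natDegree ≤ k * 1 := by
            gcongr; exact Polynomial.natDegree_X_sub_C_le _
        _ = k := mul_one k)
  rw [Polynomial.reflect_C_mul, ← mul_one ((Polynomial.X - Polynomial.C (1 : R)) ^ k), show d = k + (d - k) by omega,
    Polynomial.reflect_mul _ _ hdeg (by rw [Polynomial.natDegree_one]; exact Nat.zero_le _), reflect_X_sub_C_pow,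
    Polynomial.reflect_one, show k + (d - k) - k = d - k by omega, Polynomial.mul_comp, Polynomial.mul_comp,
    Polynomial.C_comp, Polynomial.pow_comp, Polynomial.pow_comp, Polynomial.neg_comp, Polynomial.X_comp,
    Polynomial.add_comp, Polynomial.one_comp, Polynomial.X_comp]
  simp only [map_one, one_mul]
  ring

/-- **`ι`-palindromic ⟹ palindromic.** If `Q_{2m}(P) = P` (degree `≤ 2m`) then `P̃(X) = P(X − 1)` satisfies the coefficient condition
`ã_{m−r} = ã_{m+r}` (`r ≤ m`), i.e. `X^{2m} P̃(1/X) = P̃(X)`. [folklore] -/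
theorem pal_comp_X_sub_one {P : Polynomial R} {m : ℕ} (hd : P.natDegree ≤ 2 * m)
    (hQ : (∑ k ∈ Finset.range (2 * m + 1), Polynomial.C (P.coeff k) * (-Polynomial.X) ^ k * (1 + Polynomial.X) ^ (2 * m - k)) = P) :
    ∀ r ≤ m, (P.comp (Polynomial.X - Polynomial.C 1)).coeff (m - r) =
      (1 : R) ^ r * (P.comp (Polynomial.X - Polynomial.C 1)).coeff (m + r) := by
  have href : (P.comp (Polynomial.X - Polynomial.C 1)).reflect (2 * m) = P.comp (Polynomial.X - Polynomial.C 1) := by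
    rw [reflect_comp_X_sub_one P hd, hQ]
  refine pal_of_reflect_comp_C_mul_X (q := (1 : R)) (one_mem _) ?_
  rw [map_one, one_mul, Polynomial.comp_X, one_pow, map_one, one_mul]
  exact href

/-- The degree of `P(X − 1)` is at most that of `P`. [folklore] -/
theorem natDegree_comp_X_sub_one_le (P : Polynomial R) : (P.comp (Polynomial.X - Polynomial.C 1)).natDegree ≤ P.natDegree :=
  (Polynomial.natDegree_comp_le).trans (by
    calc P.natDegree * (Polynomial.X - Polynomial.C (1 : R)).natDegree ≤ P.natDegree * 1 := by
          gcongr; exact Polynomial.natDegree_X_sub_C_le _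
      _ = P.natDegree := mul_one _)

/-- **Existence of the real counterpart from the reciprocal identity.** `deg P ≤ 2m` and `Q_{2m}(P) = P` ⟹ `P(X − 1) = X^m·h(X + X⁻¹)` —
precisely `P(X − 1) = ∑_{j ≤ m} b_j X^{m−j}(X² + 1)^j` — for some `h = ∑ b_j Y^j` of degree `≤ m` (Goresky–Tai's Proposition 36 with `q = 1`).
[cite: GoreskyTai2017RealStructuresOrdinary, App. §16.2 Prop. 36 (p0036)] -/
theorem exists_eq_transform_of_reciprocal_eq {P : Polynomial R} {m : ℕ} (hd : P.natDegree ≤ 2 * m)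
    (hQ : (∑ k ∈ Finset.range (2 * m + 1), Polynomial.C (P.coeff k) * (-Polynomial.X) ^ k * (1 + Polynomial.X) ^ (2 * m - k)) = P) :
    ∃ h : Polynomial R, h.natDegree ≤ m ∧
      P.comp (Polynomial.X - Polynomial.C 1) =
        ∑ j ∈ Finset.range (m + 1), Polynomial.C (h.coeff j) * Polynomial.X ^ (m - j) * (Polynomial.X ^ 2 + Polynomial.C 1) ^ j :=
  exists_eq_transform (1 : R) m _ ((natDegree_comp_X_sub_one_le P).trans hd) (pal_comp_X_sub_one hd hQ)

end Reflect

/-! ## §2 Back to `T = X − 1`: `P(T) = ∑ b_j (1+T)^{m−j}((1+T)² + 1)^j` -/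

section Values

variable {R : Type*} [CommRing R]

/-- From `P(X − 1) = ∑ b_j X^{m−j}(X²+1)^j` back to `T`: **`P(T) = ∑_{j ≤ m} b_j (1+T)^{m−j}((1+T)² + 1)^j`**.
[cite: GoreskyTai2017RealStructuresOrdinary, App. §16.2 «p(x) = xⁿ h(x + q/x)» (p0036)] -/
theorem eq_transform_comp_X_add_one {P h : Polynomial R} {m : ℕ}
    (hP : P.comp (Polynomial.X - Polynomial.C 1) =
      ∑ j ∈ Finset.range (m + 1), Polynomial.C (h.coeff j) * Polynomial.X ^ (m - j) * (Polynomial.X ^ 2 + Polynomial.C 1) ^ j) :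
    P = ∑ j ∈ Finset.range (m + 1), Polynomial.C (h.coeff j) * (Polynomial.X + Polynomial.C 1) ^ (m - j) *
      ((Polynomial.X + Polynomial.C 1) ^ 2 + Polynomial.C 1) ^ j := by
  have h1 : P = (P.comp (Polynomial.X - Polynomial.C 1)).comp (Polynomial.X + Polynomial.C 1) := by
    rw [Polynomial.comp_assoc, Polynomial.sub_comp, Polynomial.X_comp, Polynomial.C_comp, add_sub_cancel_right,
      Polynomial.comp_X]
  rw [h1, hP, Polynomial.sum_comp]
  refine Finset.sum_congr rfl fun j _ ↦ ?_
  rw [Polynomial.mul_comp, Polynomial.mul_comp, Polynomial.C_comp, Polynomial.pow_comp, Polynomial.pow_comp,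
    Polynomial.X_comp, Polynomial.add_comp, Polynomial.pow_comp, Polynomial.X_comp, Polynomial.C_comp]

end Values

/-! ## §3 `ι`-stability in `Λ = ℤ_p⟦T⟧`: the real counterpart of the distinguished polynomial -/

section Iota

variable {p : ℕ} [hp : Fact p.Prime]

/-- The `Λ`-identity `(1+T)^d·ι(P) = P` is the polynomial identity `Q_d(P) = P` (by `one_add_X_pow_mul_invol_coe` and injectivity of
`ℤ_p[T] → Λ`). [cite: MazurTateTeitelbaum1986Invent, Ch. I §17] -/
theorem reciprocal_eq_of_invol {P : Polynomial ℤ_[p]} {d : ℕ} (hd : P.natDegree ≤ d)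
    (hι : ((1 : IwasawaAlgebra p) + X) ^ d * invol p (P : IwasawaAlgebra p) = (P : IwasawaAlgebra p)) :
    (∑ k ∈ Finset.range (d + 1), Polynomial.C (P.coeff k) * (-Polynomial.X) ^ k * (1 + Polynomial.X) ^ (d - k)) = P := by
  have hQ := one_add_X_pow_mul_invol_coe P hd
  rw [hι] at hQ
  exact (Polynomial.coe_inj.mp hQ).symm

/-- **Converse: every real counterpart gives an `ι`-palindromic polynomial.** For any `h` of degree `≤ m`, the polynomial
`P(T) = ∑ b_j (1+T)^{m−j}((1+T)²+1)^j` satisfies `(1+T)^{2m}·ι(P) = P` in `Λ` (each summand does: `ι(1+T) = (1+T)⁻¹`). So the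
`ι`-palindromic `P` of degree `≤ 2m` are EXACTLY the `(1+T)^m h((1+T) + (1+T)⁻¹)`, `deg h ≤ m`. [cite: MazurTateTeitelbaum1986Invent, Ch. I §17] -/
theorem invol_transform_comp_X_add_one (h : Polynomial ℤ_[p]) (m : ℕ) :
    ((1 : IwasawaAlgebra p) + X) ^ (2 * m) *
        invol p ((∑ j ∈ Finset.range (m + 1), Polynomial.C (h.coeff j) * (Polynomial.X + Polynomial.C 1) ^ (m - j) *
          ((Polynomial.X + Polynomial.C 1) ^ 2 + Polynomial.C 1) ^ j : Polynomial ℤ_[p]) : IwasawaAlgebra p) =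
      ((∑ j ∈ Finset.range (m + 1), Polynomial.C (h.coeff j) * (Polynomial.X + Polynomial.C 1) ^ (m - j) *
          ((Polynomial.X + Polynomial.C 1) ^ 2 + Polynomial.C 1) ^ j : Polynomial ℤ_[p]) : IwasawaAlgebra p) := by
  have hv1 : ((1 : IwasawaAlgebra p) + X) * (1 + invol p X) = 1 := by
    have h1 := one_add_X_mul_invol_one_add_X p
    rwa [map_add, map_one] at h1
  have hcoe : ∀ (g : ℕ → Polynomial ℤ_[p]) (s : Finset ℕ),
      ((∑ i ∈ s, g i : Polynomial ℤ_[p]) : IwasawaAlgebra p) = ∑ i ∈ s, ((g i : Polynomial ℤ_[p]) : IwasawaAlgebra p) := by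
    intro g s
    rw [← Polynomial.coeToPowerSeries.ringHom_apply, map_sum]
    simp only [Polynomial.coeToPowerSeries.ringHom_apply]
  have hsum : ((∑ j ∈ Finset.range (m + 1), Polynomial.C (h.coeff j) * (Polynomial.X + Polynomial.C 1) ^ (m - j) *
          ((Polynomial.X + Polynomial.C 1) ^ 2 + Polynomial.C 1) ^ j : Polynomial ℤ_[p]) : IwasawaAlgebra p) =
      ∑ j ∈ Finset.range (m + 1), PowerSeries.C (h.coeff j) * ((1 : IwasawaAlgebra p) + X) ^ (m - j) * ((1 + X) ^ 2 + 1) ^ j := by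
    rw [hcoe]
    refine Finset.sum_congr rfl fun j _ ↦ ?_
    simp only [Polynomial.coe_mul, Polynomial.coe_pow, Polynomial.coe_C, Polynomial.coe_add, Polynomial.coe_X, Polynomial.coe_one,
      map_one]
    ring
  rw [hsum, map_sum, Finset.mul_sum]
  refine Finset.sum_congr rfl fun j hj ↦ ?_
  rw [Finset.mem_range] at hj
  have hjm : j ≤ m := Nat.le_of_lt_succ hj
  simp only [map_mul, map_pow, map_add, map_one, invol_C]
  -- `v := ι(1+X) = 1 + ιX`; `(1+X)^{2m} = (1+X)^{m-j}·((1+X)²)^j·(1+X)^{m-j}`, `(1+X)v = 1`, `(1+X)²(v²+1) = (1+X)² + 1`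
  have hsplit : ((1 : IwasawaAlgebra p) + X) ^ (2 * m) = (1 + X) ^ (m - j) * (((1 + X) ^ 2) ^ j * (1 + X) ^ (m - j)) := by
    rw [← pow_mul, ← pow_add, ← pow_add]; congr 1; omega
  have h2 : ((1 : IwasawaAlgebra p) + X) ^ (m - j) * (1 + invol p X) ^ (m - j) = 1 := by rw [← mul_pow, hv1, one_pow]
  have h3 : (((1 : IwasawaAlgebra p) + X) ^ 2) ^ j * ((1 + invol p X) ^ 2 + 1) ^ j = ((1 + X) ^ 2 + 1) ^ j := by
    rw [← mul_pow]; congr 1; linear_combination (((1 : IwasawaAlgebra p) + X) * (1 + invol p X) + 1) * hv1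
  calc ((1 : IwasawaAlgebra p) + X) ^ (2 * m) * (PowerSeries.C (h.coeff j) * (1 + invol p X) ^ (m - j) * ((1 + invol p X) ^ 2 + 1) ^ j)
      = PowerSeries.C (h.coeff j) * (1 + X) ^ (m - j) * ((((1 + X) ^ 2) ^ j * ((1 + invol p X) ^ 2 + 1) ^ j) *
          ((1 + X) ^ (m - j) * (1 + invol p X) ^ (m - j))) := by rw [hsplit]; ring
    _ = PowerSeries.C (h.coeff j) * (1 + X) ^ (m - j) * ((1 + X) ^ 2 + 1) ^ j := by rw [h2, h3, mul_one]

/-- ★★★ **THE HALF-DEGREE DESCENT (existence and uniqueness of the real counterpart).** `F ∈ Λ = ℤ_p⟦T⟧` with `F ≢ 0 (mod p)`,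
`F(0) ≠ 0`, `ι F = u·F` (`u ∈ Λˣ`), and distinguished polynomial `P` of EVEN degree `λ = 2m`. Then there is a UNIQUE monic `h ∈ ℤ_p[Y]` of
degree `m = λ/2` with **`P(X − 1) = ∑_{j ≤ m} b_j X^{m−j}(X² + 1)^j = X^m·h(X + X⁻¹)`**, i.e. `P(T) = (1+T)^m · h((1+T) + (1+T)⁻¹)`:
the palindromic `P̃(X) = P(X−1)` (`…LayerValuePalindrome`) is the Weil-type polynomial with «real counterpart» `h` (Goresky–Tai, `q = 1`).
[cite: GoreskyTai2017RealStructuresOrdinary, App. §16.2 Prop. 36 (p0036)] [cite: MazurTateTeitelbaum1986Invent, Ch. I §17]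
[cite: Washington1997, §7.1 (Weierstrass preparation, uniqueness)] -/
theorem existsUnique_realCounterpart {F : IwasawaAlgebra p} (hred : F.map (IsLocalRing.residue ℤ_[p]) ≠ 0)
    (h0 : PowerSeries.constantCoeff F ≠ 0) (hι : ∃ u : (IwasawaAlgebra p)ˣ, invol p F = u * F) {m : ℕ}
    (hm : (F.weierstrassDistinguished hred).natDegree = 2 * m) :
    ∃! h : Polynomial ℤ_[p], (h.Monic ∧ h.natDegree = m) ∧
      (F.weierstrassDistinguished hred).comp (Polynomial.X - Polynomial.C 1) =
        ∑ j ∈ Finset.range (m + 1), Polynomial.C (h.coeff j) * Polynomial.X ^ (m - j) * (Polynomial.X ^ 2 + Polynomial.C 1) ^ j := by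
  set P : Polynomial ℤ_[p] := F.weierstrassDistinguished hred with hP
  obtain ⟨-, hkey⟩ := eval_neg_one_and_invol_weierstrassDistinguished hred h0 hι
  rw [← hP, hm] at hkey
  have hQ := reciprocal_eq_of_invol hm.le hkey
  have hPd : P.IsDistinguishedAt (IsLocalRing.maximalIdeal ℤ_[p]) := F.isDistinguishedAt_weierstrassDistinguished hred
  have hmon : (P.comp (Polynomial.X - Polynomial.C 1)).Monic :=
    hPd.monic.comp (Polynomial.monic_X_sub_C 1) (by rw [Polynomial.natDegree_X_sub_C]; exact one_ne_zero)
  have hdeg : (P.comp (Polynomial.X - Polynomial.C 1)).natDegree = 2 * m := by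
    rw [Polynomial.natDegree_comp, Polynomial.natDegree_X_sub_C, mul_one, hm]
  exact existsUnique_monic_eq_transform 1 m _ hmon hdeg (pal_comp_X_sub_one hm.le hQ)

/-- `𝒯_{1,m}((Y − 2)^m) = (X − 1)^{2m}` over any commutative ring: the real counterpart of `(X − 1)^{2m}` is `(Y − 2)^m` (`X + X⁻¹ = 2` at the
double root `X = 1`). [cite: GoreskyTai2017RealStructuresOrdinary, App. §16.2 «β_i = α_i + q/α_i» (p0036)] -/
theorem transform_X_sub_two_pow {R : Type*} [CommRing R] (m : ℕ) :
    (∑ j ∈ Finset.range (m + 1), Polynomial.C (((Polynomial.X - Polynomial.C (2 : R)) ^ m).coeff j) * Polynomial.X ^ (m - j) *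
        (Polynomial.X ^ 2 + Polynomial.C 1) ^ j) = (Polynomial.X - Polynomial.C 1) ^ (2 * m) := by
  induction m with
  | zero => rw [pow_zero, mul_zero, pow_zero, ← Polynomial.C_1, transform_C, Polynomial.C_1, one_mul, pow_zero]
  | succ m ih =>
    have hdeg : ((Polynomial.X - Polynomial.C (2 : R)) ^ m).natDegree ≤ m :=
      (Polynomial.natDegree_pow_le).trans (by
        calc m * (Polynomial.X - Polynomial.C (2 : R)).natDegree ≤ m * 1 := by gcongr; exact Polynomial.natDegree_X_sub_C_le _
          _ = m := mul_one m)
    rw [pow_succ, transform_mul (1 : R) hdeg (Polynomial.natDegree_X_sub_C_le 2), ih, transform_X_sub_C, mul_add 2 m 1, mul_one,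
      pow_add]
    congr 1
    rw [show (Polynomial.C (2 : R)) = 2 from map_ofNat _ 2, map_one]
    ring

/-- ★★ **The real counterpart is congruent to `(Y − 2)^m` modulo `p`**: with `P` distinguished of degree `2m` and `P(X−1) = 𝒯_{1,m}(h)`,
`deg h ≤ m`, one has `h ≡ (Y − 2)^m (mod p)` (reduce `P ≡ T^{2m}`: `P̃ ≡ (X−1)^{2m} = 𝒯_{1,m}((Y−2)^m)`, and the transform is injective). At
`p = 2`: `h ≡ Y^m`, i.e. **`h` is itself distinguished** (all lower coefficients even). [cite: GoreskyTai2017RealStructuresOrdinary, App. §16.2 Prop. 36 (p0036)]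
[cite: Washington1997, §7.1 (Weierstrass preparation, uniqueness)] -/
theorem map_residue_realCounterpart {P h : Polynomial ℤ_[p]} {m : ℕ} (hPd : P.IsDistinguishedAt (IsLocalRing.maximalIdeal ℤ_[p]))
    (hm : P.natDegree = 2 * m) (hn : h.natDegree ≤ m)
    (hPh : P.comp (Polynomial.X - Polynomial.C 1) =
      ∑ j ∈ Finset.range (m + 1), Polynomial.C (h.coeff j) * Polynomial.X ^ (m - j) * (Polynomial.X ^ 2 + Polynomial.C 1) ^ j) :
    h.map (IsLocalRing.residue ℤ_[p]) = (Polynomial.X - Polynomial.C 2) ^ m := by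
  set π := IsLocalRing.residue ℤ_[p] with hπ
  have hPmap : P.map π = Polynomial.X ^ (2 * m) := by rw [← hm]; exact hPd.map_eq_X_pow
  have h1 := congrArg (Polynomial.map π) hPh
  have hπ1 : π 1 = 1 := map_one π
  rw [Polynomial.map_comp, hPmap, Polynomial.map_sub, Polynomial.map_X, Polynomial.map_C, hπ1, transform_map, hπ1,
    Polynomial.pow_comp, Polynomial.X_comp, ← transform_X_sub_two_pow m] at h1
  have hdeg : ((Polynomial.X - Polynomial.C (2 : IsLocalRing.ResidueField ℤ_[p])) ^ m).natDegree ≤ m :=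
    (Polynomial.natDegree_pow_le).trans (by
      calc m * (Polynomial.X - Polynomial.C (2 : IsLocalRing.ResidueField ℤ_[p])).natDegree ≤ m * 1 := by
            gcongr; exact Polynomial.natDegree_X_sub_C_le _
        _ = m := mul_one m)
  exact (transform_injective 1 m hdeg ((Polynomial.natDegree_map_le).trans hn) h1).symm

/-- ★★ **In `Λ`: `P = (1+T)^m · h(γ + γ⁻¹)`**, `γ = 1 + T`, `γ⁻¹ = ι(1+T)`: the distinguished polynomial is, up to the unit `(1+T)^m`, the
real counterpart evaluated at the `ι`-FIXED element `γ + γ⁻¹ = 2 + T + ι(T)` of `Λ` (so `(F) = (h(γ + γ⁻¹))` is generated by an `ι`-fixed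
element of the fixed ring `Λ^ι = ℤ_p⟦T + ιT⟧`). [cite: MazurTateTeitelbaum1986Invent, Ch. I §17] [cite: GoreskyTai2017RealStructuresOrdinary, App. §16.2 (p0036)] -/
theorem coe_eq_one_add_X_pow_mul_aeval {P h : Polynomial ℤ_[p]} {m : ℕ} (hn : h.natDegree ≤ m)
    (hPh : P.comp (Polynomial.X - Polynomial.C 1) =
      ∑ j ∈ Finset.range (m + 1), Polynomial.C (h.coeff j) * Polynomial.X ^ (m - j) * (Polynomial.X ^ 2 + Polynomial.C 1) ^ j) :
    (P : IwasawaAlgebra p) = ((1 : IwasawaAlgebra p) + X) ^ m * Polynomial.aeval (((1 : IwasawaAlgebra p) + X) + invol p (1 + X)) h := by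
  set v : IwasawaAlgebra p := invol p (1 + X) with hv
  have hv1 : ((1 : IwasawaAlgebra p) + X) * v = 1 := one_add_X_mul_invol_one_add_X p
  have hT := eq_transform_comp_X_add_one hPh
  have hcoe : ∀ (g : ℕ → Polynomial ℤ_[p]) (s : Finset ℕ),
      ((∑ i ∈ s, g i : Polynomial ℤ_[p]) : IwasawaAlgebra p) = ∑ i ∈ s, ((g i : Polynomial ℤ_[p]) : IwasawaAlgebra p) := by
    intro g s
    rw [← Polynomial.coeToPowerSeries.ringHom_apply, map_sum]
    simp only [Polynomial.coeToPowerSeries.ringHom_apply]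
  conv_lhs => rw [hT]
  rw [hcoe, Polynomial.aeval_eq_sum_range' (Nat.lt_succ_of_le hn), Finset.mul_sum]
  refine Finset.sum_congr rfl fun j hj ↦ ?_
  rw [Finset.mem_range] at hj
  have hjm : j ≤ m := Nat.le_of_lt_succ hj
  simp only [Polynomial.coe_mul, Polynomial.coe_pow, Polynomial.coe_C, Polynomial.coe_add, Polynomial.coe_X, Polynomial.coe_one,
    map_one]
  have hkey : ((X : IwasawaAlgebra p) + 1) ^ 2 + 1 = (1 + X) * ((1 + X) + v) := by
    linear_combination (-1 : IwasawaAlgebra p) * hv1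
  have hsm : h.coeff j • (((1 : IwasawaAlgebra p) + X) + v) ^ j = PowerSeries.C (h.coeff j) * ((1 + X) + v) ^ j := by
    rw [Algebra.smul_def]; rfl
  rw [hkey, hsm, mul_pow, show ((X : IwasawaAlgebra p) + 1) = 1 + X from add_comm _ _]
  have hsplit : ((1 : IwasawaAlgebra p) + X) ^ m = (1 + X) ^ (m - j) * (1 + X) ^ j := by
    rw [← pow_add, Nat.sub_add_cancel hjm]
  rw [hsplit]; ring

/-- ★★★ **THE CHARACTERISTIC ELEMENT DESCENDS TO THE FIXED RING.** `F ∈ Λ`, `F ≢ 0 (mod p)`, `F(0) ≠ 0`, `ι F = u·F`, `λ = 2m`: with `h`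
THE real counterpart (`existsUnique_realCounterpart`), **`F = h(γ + γ⁻¹) · w`** for a unit `w ∈ Λˣ` — the ideal `(F)` is generated by the
`ι`-fixed element `h(γ + γ⁻¹)`, `γ = 1+T`. [cite: MazurTateTeitelbaum1986Invent, Ch. I §17] [cite: Washington1997, §7.1 (Weierstrass preparation, uniqueness)] -/
theorem exists_eq_aeval_realCounterpart_mul_unit {F : IwasawaAlgebra p} (hred : F.map (IsLocalRing.residue ℤ_[p]) ≠ 0) {h : Polynomial ℤ_[p]}
    {m : ℕ} (hn : h.natDegree ≤ m)
    (hPh : (F.weierstrassDistinguished hred).comp (Polynomial.X - Polynomial.C 1) =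
      ∑ j ∈ Finset.range (m + 1), Polynomial.C (h.coeff j) * Polynomial.X ^ (m - j) * (Polynomial.X ^ 2 + Polynomial.C 1) ^ j) :
    ∃ w : (IwasawaAlgebra p)ˣ, F = Polynomial.aeval (((1 : IwasawaAlgebra p) + X) + invol p (1 + X)) h * w := by
  have hfac : F = (F.weierstrassDistinguished hred : IwasawaAlgebra p) * F.weierstrassUnit hred :=
    F.eq_weierstrassDistinguished_mul_weierstrassUnit hred
  have hU : IsUnit (F.weierstrassUnit hred) := F.isUnit_weierstrassUnit hred
  have h1X : IsUnit (((1 : IwasawaAlgebra p) + X) ^ m) := by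
    refine IsUnit.pow m ?_
    rw [PowerSeries.isUnit_iff_constantCoeff, map_add, map_one, constantCoeff_X, add_zero]
    exact isUnit_one
  refine ⟨(h1X.mul hU).unit, ?_⟩
  rw [IsUnit.unit_spec]
  conv_lhs => rw [hfac, coe_eq_one_add_X_pow_mul_aeval hn hPh]
  ring

/-- `ι`-stability passes to the `p`-free part: `ι F = u·F`, `F = p^μ·G` ⟹ `ι G = u·G` (`Λ` is a domain). [cite: MazurTateTeitelbaum1986Invent, Ch. I §17] -/
theorem invol_pfree {F : IwasawaAlgebra p} (hι : ∃ u : (IwasawaAlgebra p)ˣ, invol p F = u * F) :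
    ∃ u : (IwasawaAlgebra p)ˣ, invol p (pfree F) = u * pfree F := by
  obtain ⟨u, hu⟩ := hι
  refine ⟨u, mul_left_cancel₀ (C_pow_ne_zero (p := p) (mu F)) ?_⟩
  have h1 : invol p (PowerSeries.C ((p : ℤ_[p]) ^ mu F) * pfree F) = u * (PowerSeries.C ((p : ℤ_[p]) ^ mu F) * pfree F) := by
    rw [← eq_C_pow_mu_mul_pfree F]; exact hu
  rw [map_mul, invol_C] at h1
  rw [h1]; ring

/-- ★★★ **THE HALF-DEGREE DESCENT, `(μ, λ)` form.** `F ∈ Λ ∖ {0}`, `F(0) ≠ 0`, `ι F = u·F`, `λ(F) = 2m`: the distinguished polynomial `P` of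
(the `p`-free part of) `F` — `F = p^{μ(F)}·P·U` — has a UNIQUE monic real counterpart `h` of degree `m = λ(F)/2`: `P(X − 1) = X^m h(X + X⁻¹)`.
[cite: GoreskyTai2017RealStructuresOrdinary, App. §16.2 Prop. 36 (p0036)] [cite: Washington1997, §7.1 (Weierstrass preparation, uniqueness)] -/
theorem existsUnique_realCounterpart_of_lam {F : IwasawaAlgebra p} (hF : F ≠ 0) (h0 : PowerSeries.constantCoeff F ≠ 0)
    (hι : ∃ u : (IwasawaAlgebra p)ˣ, invol p F = u * F) {m : ℕ} (hlam : lam F = 2 * m) :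
    ∃! h : Polynomial ℤ_[p], (h.Monic ∧ h.natDegree = m) ∧
      ((pfree F).weierstrassDistinguished (red_pfree_ne_zero hF)).comp (Polynomial.X - Polynomial.C 1) =
        ∑ j ∈ Finset.range (m + 1), Polynomial.C (h.coeff j) * Polynomial.X ^ (m - j) * (Polynomial.X ^ 2 + Polynomial.C 1) ^ j :=
  -- `(pfree F)(0) ≠ 0` (also `…EisensteinShaCurrency.constantCoeff_pfree_ne_zero`, not imported here)
  have h0' : PowerSeries.constantCoeff (pfree F) ≠ 0 := fun h ↦ h0 (by rw [eq_C_pow_mu_mul_pfree F, map_mul, h, mul_zero])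
  existsUnique_realCounterpart (red_pfree_ne_zero hF) h0' (invol_pfree hι)
    (by rw [← lam_eq_natDegree_weierstrassDistinguished (eq_C_pow_mu_mul_pfree F) (red_pfree_ne_zero hF), hlam])

/-- ★★★ **`F = p^{μ(F)} · h(γ + γ⁻¹) · w`**, `w ∈ Λˣ`: the ideal `(F)` of an `ι`-stable `F ≠ 0` with `F(0) ≠ 0` and even `λ` is generated by
`p^μ` times the real counterpart evaluated at the `ι`-fixed element `γ + γ⁻¹` (`γ = 1+T`). [cite: MazurTateTeitelbaum1986Invent, Ch. I §17]
[cite: Washington1997, §7.1 (Weierstrass preparation, uniqueness)] -/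
theorem exists_eq_C_pow_mu_mul_aeval_mul_unit {F : IwasawaAlgebra p} (hF : F ≠ 0) {h : Polynomial ℤ_[p]} {m : ℕ} (hn : h.natDegree ≤ m)
    (hPh : ((pfree F).weierstrassDistinguished (red_pfree_ne_zero hF)).comp (Polynomial.X - Polynomial.C 1) =
      ∑ j ∈ Finset.range (m + 1), Polynomial.C (h.coeff j) * Polynomial.X ^ (m - j) * (Polynomial.X ^ 2 + Polynomial.C 1) ^ j) :
    ∃ w : (IwasawaAlgebra p)ˣ,
      F = PowerSeries.C ((p : ℤ_[p]) ^ mu F) * Polynomial.aeval (((1 : IwasawaAlgebra p) + X) + invol p (1 + X)) h * w := by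
  obtain ⟨w, hw⟩ := exists_eq_aeval_realCounterpart_mul_unit (red_pfree_ne_zero hF) hn hPh
  refine ⟨w, ?_⟩
  conv_lhs => rw [eq_C_pow_mu_mul_pfree F]
  rw [hw, mul_assoc]

end Iota


end Summit.BirchSwinnertonDyer.BirchSwinnertonDyer.Theorems.AlignedTransportAtTwoHalfDescent

end
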